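import Mathlib
import HarnessLib
import Summits.HubbardSuperconductivity.HubbardSuperconductivity.Theorems.KLProgrammeKLRegimeEngineTowerLevLawBaseTok

/-!
# Route `KLProgramme` — crux K3 ENGINE (stmt-HubbardSuperconductivity-20437 `KLRegimeEngineV17F2`), stub (b) v2, THE LEVELS PACKAGE (ℓ):
# «(ℓ)-READOUT-F», model layers M1/M2 WITH THE PROFILE ROWS EXPORTED — the tokenised re-based floor-keyed law whose conclusion also RETURNS the kit's Chernoff
# data of every block (cell gate-hubbard-kl, seat hubbard-kl-k3c3-p2 g16; export twins of …TowerLevLawBaseTok; the originals are untouched)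

WHY.  The read-out of `𝒱_j` at a level `j ∈ [dk, d(k+1))` (stub (b)'s `KernelNormsLevels … j`) bounds the partial-block increment `𝒱_j − 𝒱_{dk}` by E1's part 7
`towerReadoutIncrement_le`, which needs the measured profile of the block input `𝒱_{dk}` — `W·Z^m·klTowerMuLevF … d k m ≤ A′λ^{m−1}Q′^m`, `W·Z³·… ≤ ι₃λ²` — with THE
SAME `(A′, Q′, ι₃)` the law's numerics are stated for.  Those rows are derived INSIDE the law's chain (M1's bridge `hR`, M2's re-measurement) from existential
constants, so no separately stated theorem can reproduce them with the same constants; the only way to hand them to a consumer is to EXPORT them in the law's own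
conclusion.  This file does that for the first two model layers:

* **`klTowerBLevF_le_law_of_inputs_base_tokX`** — `…_tok` with `hR` asked up to `k ≤ K_b` and the conclusion
  `(∀ k, 1 ≤ k ≤ K_b → Zk k) ∧ (law) ∧ (∀ k, 1 ≤ k ≤ K_b → profile rows of block k)`;
* **`klTowerBLevF_le_law_of_base_rows_tokX`** — `…_tok` with the cell asked up to `k ≤ K_b` and the same enlarged conclusion.
Compositions of landed theorems and real algebra; nothing about the model is asserted beyond them; nothing asserts (ℓ), any stub, K3 or superconductivity.
References: BGM 2006 §2.8 (2.83), (2.93)–(2.98), §3 (3.2)–(3.8) [cite: BenfattoGiulianiMastropietro2006].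
-/


noncomputable section

namespace Summit.HubbardSuperconductivity.HubbardSuperconductivity.Theorems.EngineV8

set_option linter.dupNamespace false -- summit = problem name (single-conjunct summit), D-0017

open Classical
open Real Finset Literature.MathematicalPhysics.QuantumLattice Literature.Probability.LatticeModels GrassmannAlgebra
open Literature.MathematicalPhysics.QuantumLattice.FermiRG
open Summit.HubbardSuperconductivity.HubbardSuperconductivity.Theorems.KLProgrammeLegKernels
open Summit.HubbardSuperconductivity.HubbardSuperconductivity.Theorems.KLRegimeSplit
open Summit.HubbardSuperconductivity.HubbardSuperconductivity.Theorems.KLRegimeWick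
open Summit.HubbardSuperconductivity.HubbardSuperconductivity.Theorems.TorusFourierL2
open Summit.HubbardSuperconductivity.HubbardSuperconductivity.Theorems.DispersionFlow
open Summit.HubbardSuperconductivity.HubbardSuperconductivity.Theorems.PerturbedFermiCurve

variable {L M : ℕ} [NeZero L] [NeZero M]

/-! ## §1 M1: named inputs, token carried, rows exported -/

omit [NeZero L] [NeZero M] in
/-- **THE RE-BASED FLOOR-KEYED LAW FROM NAMED INPUTS, TOKEN CARRIED, PROFILE ROWS EXPORTED** («(ℓ)-READOUT-F» twin of
`klTowerBLevF_le_law_of_inputs_base_tok`: the bridge `hR` is asked up to `k ≤ K_b`, and the conclusion also RETURNS, for every block `1 ≤ k ≤ K_b`, the measured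
profile rows `W·Z^m·klTowerMuLevF … d k m ≤ A′λ^{m−1}Q′^m` (`4 ≤ m ≤ D`) and `W·Z³·klTowerMuLevF … d k 3 ≤ ι₃λ²` — the kit's Chernoff data of block `k`, which every
read-out / partial-block consumer of the law needs with THE SAME `(A′, Q′, ι₃)`). [cite: BenfattoGiulianiMastropietro2006, §2.8 (2.83), (2.93)-(2.98)] -/
theorem klTowerBLevF_le_law_of_inputs_base_tokX {L M : ℕ} [NeZero L] [NeZero M] {β : ℝ} (hβ : 0 < β) (U μ : ℝ) (K : TrigPolyC4v)
    (d Kb D : ℕ) {A lam Q W Z A' Q' σ Φ ψ τ ι₁ ι₂ ι₃ : ℝ} {Zk : ℕ → Prop} (hD3 : 3 ≤ D)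
    (hA : 0 ≤ A) (hlam : 0 < lam) (hQ : 0 ≤ Q) (hW : 0 ≤ W) (hZ : 0 ≤ Z) (hA'0 : 0 ≤ A') (hQ'0 : 0 < Q')
    (hσ : 0 ≤ σ) (hΦ : 0 ≤ Φ) (hψ : 0 ≤ ψ) (hτ : 0 < τ)
    -- the base profile at block 1
    (hbase : ∀ m, 4 ≤ m → m ≤ D → W * Z ^ m * klTowerMuLevF L M β U μ K d 1 m ≤ A' * lam ^ (m - 1) * Q' ^ m)
    (hbase3 : 3 ≤ D → W * Z ^ 3 * klTowerMuLevF L M β U μ K d 1 3 ≤ ι₃ * lam ^ 2)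
    -- the re-based re-measurement bridge at blocks k ≥ 2
    (hR : ∀ k, 2 ≤ k → k ≤ Kb →
      (∀ k', 2 ≤ k' → k' ≤ k → ∀ t : Fin 5, ∀ p, 3 ≤ p → p ≤ D → klTowerBLevF L M β U μ K d t k' p ≤ A * lam ^ (p - 1) * Q ^ p) →
      (∀ m, 4 ≤ m → m ≤ D → W * Z ^ m * klTowerMuLevF L M β U μ K d k m ≤ A' * lam ^ (m - 1) * Q' ^ m) ∧
        (3 ≤ D → W * Z ^ 3 * klTowerMuLevF L M β U μ K d k 3 ≤ ι₃ * lam ^ 2))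
    -- the imports at blocks k ≥ 1
    (hι₁ : ∀ k, 1 ≤ k → k < Kb → W * Z ^ 1 * klTowerMuLevF L M β U μ K d k 1 ≤ ι₁ * lam)
    (hι₂ : ∀ k, 1 ≤ k → k < Kb → W * Z ^ 2 * klTowerMuLevF L M β U μ K d k 2 ≤ ι₂ * lam)
    -- the token along the blocks («(ℓ)-Z-THREAD»): base, and propagation under the step's guard
    (hZ1 : Zk 1)
    (hZsucc : ∀ k, 1 ≤ k → k < Kb → Zk k → Φ * towerV D τ (fun m => W * Z ^ m * klTowerMuLevF L M β U μ K d k m) < 1 → Zk (k + 1))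
    -- the floor-keyed step at blocks k ≥ 1 («(I1)-LEV-FLOOR» LINK), which may use the token at its own block
    (hstep : ∀ t : Fin 5, ∀ k, 1 ≤ k → k < Kb → Zk k → ∀ N : ℕ, 2 ≤ N → ∀ p, 3 ≤ p → p ≤ D →
      Φ * towerV D τ (fun m => W * Z ^ m * klTowerMuLevF L M β U μ K d k m) < 1 →
      klTowerBLevF L M β U μ K d t (k + 1) p ≤
        towerFO D σ (fun m => W * Z ^ m * klTowerMuLevF L M β U μ K d k m) p +
          ∑ n ∈ Icc 2 N, exp 1 * Φ ^ (n - 1) * ψ ^ p * towerS D τ (fun m => W * Z ^ m * klTowerMuLevF L M β U μ K d k m) n p +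
          ψ ^ p * exp 1 * towerV D τ (fun m => W * Z ^ m * klTowerMuLevF L M β U μ K d k m) *
            (Φ * towerV D τ (fun m => W * Z ^ m * klTowerMuLevF L M β U μ K d k m)) ^ N /
            (1 - Φ * towerV D τ (fun m => W * Z ^ m * klTowerMuLevF L M β U μ K d k m)))
    -- the kit's numerics
    (hx₁ : 4 * σ * lam * Q' < 1) (hx₂ : 2 * lam * τ * Q' ≤ 1) (hx₃ : exp 1 * τ * lam * Q' < 1)
    (hy : Φ * (τ * (ι₁ * lam + ι₂ / (2 * Q') + ι₃ / (4 * Q' ^ 2) + A' * Q' / 4)) < 1)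
    (hθ : Φ * (exp 1 * τ * (ι₁ * lam) + (exp 1 * τ) ^ 2 * (ι₂ * lam) + (exp 1 * τ) ^ 3 * (ι₃ * lam ^ 2) +
      A' * (exp 1 * τ * Q') * ((exp 1 * τ * lam * Q') ^ 3 / (1 - exp 1 * τ * lam * Q'))) < 1)
    (hu₁ : 4 * Q' ≤ Q) (hu₂ : 2 * τ * ψ * Q' ≤ Q)
    (hclose : A' * (4 * Q') ^ 3 * (4 * σ * lam * Q' / (1 - 4 * σ * lam * Q')) +
      exp 1 * ψ * (2 * τ * ψ * Q') ^ 2 * (τ * (ι₁ * lam + ι₂ / (2 * Q') + ι₃ / (4 * Q' ^ 2) + A' * Q' / 4)) *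
        (Φ * (τ * (ι₁ * lam + ι₂ / (2 * Q') + ι₃ / (4 * Q' ^ 2) + A' * Q' / 4)) /
          (1 - Φ * (τ * (ι₁ * lam + ι₂ / (2 * Q') + ι₃ / (4 * Q' ^ 2) + A' * Q' / 4)))) ≤ A * Q ^ 3) :
    (∀ k, 1 ≤ k → k ≤ Kb → Zk k) ∧
    (∀ k, 2 ≤ k → k ≤ Kb → ∀ (t : Fin 5) (p : ℕ), 3 ≤ p → p ≤ D →
      klTowerBLevF L M β U μ K d t k p ≤ A * lam ^ (p - 1) * Q ^ p) ∧
    (∀ k, 1 ≤ k → k ≤ Kb →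
      (∀ m, 4 ≤ m → m ≤ D → W * Z ^ m * klTowerMuLevF L M β U μ K d k m ≤ A' * lam ^ (m - 1) * Q' ^ m) ∧
      (3 ≤ D → W * Z ^ 3 * klTowerMuLevF L M β U μ K d k 3 ≤ ι₃ * lam ^ 2)) := by
  have hWZ : ∀ m : ℕ, 0 ≤ W * Z ^ m := fun m => by positivity
  have hprof : ∀ k, 1 ≤ k → k < Kb →
      (∀ k', 2 ≤ k' → k' ≤ k → ∀ t : Fin 5, ∀ p, 3 ≤ p → p ≤ D → klTowerBLevF L M β U μ K d t k' p ≤ A * lam ^ (p - 1) * Q ^ p) →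
      ∀ m, 4 ≤ m → m ≤ D → W * Z ^ m * klTowerMuLevF L M β U μ K d k m ≤ A' * lam ^ (m - 1) * Q' ^ m := by
    intro k hk1 hkK ih m hm hmD
    rcases Nat.lt_or_ge k 2 with hk | hk
    · obtain rfl : k = 1 := by omega
      exact hbase m hm hmD
    · exact (hR k hk hkK.le ih).1 m hm hmD
  have hprof3 : ∀ k, 1 ≤ k → k < Kb → 3 ≤ D →
      (∀ k', 2 ≤ k' → k' ≤ k → ∀ t : Fin 5, ∀ p, 3 ≤ p → p ≤ D → klTowerBLevF L M β U μ K d t k' p ≤ A * lam ^ (p - 1) * Q ^ p) →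
      W * Z ^ 3 * klTowerMuLevF L M β U μ K d k 3 ≤ ι₃ * lam ^ 2 := by
    intro k hk1 hkK hD3' ih
    rcases Nat.lt_or_ge k 2 with hk | hk
    · obtain rfl : k = 1 := by omega
      exact hbase3 hD3'
    · exact (hR k hk hkK.le ih).2 hD3'
  obtain ⟨hZ, hlaw⟩ := towerBorn_le_law_tracks_of_profile_base_tok (T := Fin 5) (K := Kb) (D := D)
    (b := fun t k p => klTowerBLevF L M β U μ K d t k p) (μ := fun k m => W * Z ^ m * klTowerMuLevF L M β U μ K d k m)
    (A := A) (lam := lam) (Q := Q) (A' := A') (Q' := Q') (ι₃ := ι₃) (Zk := Zk) hD3 hlam hA hQ hσ hΦ hψ hτ hQ'0 hA'0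
    (fun k _ m => mul_nonneg (hWZ m) (klTowerMuLevF_nonneg hβ U μ K d k m)) hZ1 hZsucc hprof hprof3 hι₁ hι₂ hstep hx₁ hx₂ hx₃ hy hθ hu₁ hu₂ hclose
  refine ⟨hZ, hlaw, fun k hk1 hkK => ?_⟩
  rcases Nat.lt_or_ge k 2 with hk | hk
  · obtain rfl : k = 1 := by omega
    exact ⟨hbase, hbase3⟩
  · exact hR k hk hkK (fun k' hk'2 hk'le t p hp hpD => hlaw k' hk'2 (hk'le.trans hkK) t p hp hpD)

/-! ## §2 M2: bridge discharged, token carried, rows exported -/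

omit [NeZero L] [NeZero M] in
/-- **THE RE-BASED LEVELLED TOWER LAW, BRIDGE DISCHARGED, TOKEN CARRIED, PROFILE ROWS EXPORTED** («(ℓ)-READOUT-F» twin of
`klTowerBLevF_le_law_of_base_rows_tok`: the six-leg cell is asked up to `k ≤ K_b`, and the conclusion also returns the measured profile rows of every block
`1 ≤ k ≤ K_b` at `(A′, Q′, ι₃)`). [cite: BenfattoGiulianiMastropietro2006, §2.8 (2.83), (2.93)-(2.98)] -/
theorem klTowerBLevF_le_law_of_base_rows_tokX :
    ∃ C₁ C₂ : ℝ, 0 < C₁ ∧ 0 < C₂ ∧ ∀ R : RenConsts, R.WF2 → ∃ c₃' : ℝ, 0 < c₃' ∧ ∃ U₀' : ℝ, 0 < U₀' ∧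
      ∀ (P : SplitConsts) (c : ℝ), P.WF → 0 < c → c ≤ klEngC₃6 P R → c ≤ c₃' →
      ∀ μ ∈ klWindowC, ∀ U : ℝ, 0 < U → U ≤ klEngU₀9 P R c → U ≤ U₀' → ∀ β : ℝ, klBetaMin ≤ β → β ≤ Real.exp (c / U ^ 2) →
      ∀ K : TrigPolyC4v, FrameOK R U (nScales β) μ K → ∀ (L M : ℕ) [NeZero L] [NeZero M],
      klEngL₃ β U ≤ L → klEngM₃ β U L ≤ M → ∀ d Kb D : ℕ, 2 ≤ d → d * Kb - 1 ≤ nScales β + 1 → 3 ≤ D →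
      ∀ (A lam Q Ab Qb : ℝ), 0 ≤ A → 0 < lam → 0 < Q → 0 ≤ Ab → 0 ≤ Qb →
      -- the base datum at the family `F_{d−1}` and its unit law (k3c2-p3 «(ℓ)-BASE-LEV» p668143 / p670020 from p3's grid step)
      ∀ Nb : Fin 5 → ℕ → ℝ, (∀ t p, 0 ≤ Nb t p) →
        (∀ (t : Fin 5) (p : ℕ) (Ωe' : Fin (2 * p) → Option (SectorLeg (sectorCount (d - 1)))), levelCount Ωe' = (t : ℕ) + 1 →
          klLevNormOf L M β μ K (d - 1) (2 * p) (klTowerInput L M β U μ K d 1) Ωe' ≤ Nb t p) →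
        (∀ (t : Fin 5) (p : ℕ), 3 ≤ p → Nb t p / klLevUnitF β M t p (d - 1) ≤ Ab * lam ^ (p - 1) * Qb ^ p) →
      ∀ (W Z A' Q' : ℝ), 0 < W → 0 < Z →
        W * ((27 : ℝ) ^ 5 * (C₁ / C₂) * (8 : ℝ) ^ (d - 1) * (Ab + A / (1 - ((2 : ℝ) ^ d)⁻¹))) ≤ A' →
        Z * (C₂ ^ 2 * ((2 : ℝ) ^ (d - 1))⁻¹ * max Q Qb) ≤ Q' → 0 < Q' →
      ∀ (σ Φ ψ τ ι₁ ι₂ ι₃ X : ℝ), 0 ≤ σ → 0 ≤ Φ → 0 ≤ ψ → 0 < τ → W * Z ^ 3 * X ≤ ι₃ → A' * Q' ^ 3 ≤ ι₃ →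
      -- the block-1 profile (named)
      (∀ m, 4 ≤ m → m ≤ D → W * Z ^ m * klTowerMuLevF L M β U μ K d 1 m ≤ A' * lam ^ (m - 1) * Q' ^ m) →
      (3 ≤ D → W * Z ^ 3 * klTowerMuLevF L M β U μ K d 1 3 ≤ ι₃ * lam ^ 2) →
      -- the imports (E1 (I4))
      (∀ k, 1 ≤ k → k < Kb → W * Z ^ 1 * klTowerMuLevF L M β U μ K d k 1 ≤ ι₁ * lam) →
      (∀ k, 1 ≤ k → k < Kb → W * Z ^ 2 * klTowerMuLevF L M β U μ K d k 2 ≤ ι₂ * lam) →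
      -- the located six-leg cell «(I2)-F1-HMU» at the blocks `k ≥ 2`
      (∀ k, 2 ≤ k → k ≤ Kb → klTowerMuLevAtF L M β U μ K d 0 k 3 ≤ X * lam ^ 2) →
      -- the token along the blocks («(ℓ)-Z-THREAD»): base, and propagation under the step's guard
      ∀ Zk : ℕ → Prop, Zk 1 →
      (∀ k, 1 ≤ k → k < Kb → Zk k → Φ * towerV D τ (fun m => W * Z ^ m * klTowerMuLevF L M β U μ K d k m) < 1 → Zk (k + 1)) →
      -- the step at blocks `k ≥ 1`, which may use the token at its own block
      (∀ t : Fin 5, ∀ k, 1 ≤ k → k < Kb → Zk k → ∀ N : ℕ, 2 ≤ N → ∀ p, 3 ≤ p → p ≤ D →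
        Φ * towerV D τ (fun m => W * Z ^ m * klTowerMuLevF L M β U μ K d k m) < 1 →
        klTowerBLevF L M β U μ K d t (k + 1) p ≤
          towerFO D σ (fun m => W * Z ^ m * klTowerMuLevF L M β U μ K d k m) p +
            ∑ n ∈ Icc 2 N, exp 1 * Φ ^ (n - 1) * ψ ^ p * towerS D τ (fun m => W * Z ^ m * klTowerMuLevF L M β U μ K d k m) n p +
            ψ ^ p * exp 1 * towerV D τ (fun m => W * Z ^ m * klTowerMuLevF L M β U μ K d k m) *
              (Φ * towerV D τ (fun m => W * Z ^ m * klTowerMuLevF L M β U μ K d k m)) ^ N /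
              (1 - Φ * towerV D τ (fun m => W * Z ^ m * klTowerMuLevF L M β U μ K d k m))) →
      -- the kit's numerics (E1 (I5))
      4 * σ * lam * Q' < 1 → 2 * lam * τ * Q' ≤ 1 → exp 1 * τ * lam * Q' < 1 →
      Φ * (τ * (ι₁ * lam + ι₂ / (2 * Q') + ι₃ / (4 * Q' ^ 2) + A' * Q' / 4)) < 1 →
      Φ * (exp 1 * τ * (ι₁ * lam) + (exp 1 * τ) ^ 2 * (ι₂ * lam) + (exp 1 * τ) ^ 3 * (ι₃ * lam ^ 2) +
        A' * (exp 1 * τ * Q') * ((exp 1 * τ * lam * Q') ^ 3 / (1 - exp 1 * τ * lam * Q'))) < 1 →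
      4 * Q' ≤ Q → 2 * τ * ψ * Q' ≤ Q →
      A' * (4 * Q') ^ 3 * (4 * σ * lam * Q' / (1 - 4 * σ * lam * Q')) +
        exp 1 * ψ * (2 * τ * ψ * Q') ^ 2 * (τ * (ι₁ * lam + ι₂ / (2 * Q') + ι₃ / (4 * Q' ^ 2) + A' * Q' / 4)) *
          (Φ * (τ * (ι₁ * lam + ι₂ / (2 * Q') + ι₃ / (4 * Q' ^ 2) + A' * Q' / 4)) /
            (1 - Φ * (τ * (ι₁ * lam + ι₂ / (2 * Q') + ι₃ / (4 * Q' ^ 2) + A' * Q' / 4)))) ≤ A * Q ^ 3 →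
      (∀ k, 1 ≤ k → k ≤ Kb → Zk k) ∧
      (∀ k, 2 ≤ k → k ≤ Kb → ∀ (t : Fin 5) (p : ℕ), 3 ≤ p → p ≤ D →
        klTowerBLevF L M β U μ K d t k p ≤ A * lam ^ (p - 1) * Q ^ p) ∧
      (∀ k, 1 ≤ k → k ≤ Kb →
        (∀ m, 4 ≤ m → m ≤ D → W * Z ^ m * klTowerMuLevF L M β U μ K d k m ≤ A' * lam ^ (m - 1) * Q' ^ m) ∧
        (3 ≤ D → W * Z ^ 3 * klTowerMuLevF L M β U μ K d k 3 ≤ ι₃ * lam ^ 2)) := by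
  obtain ⟨C₁, C₂, hC₁, hC₂, h⟩ := klTowerMuLevF_le_profileR_base
  refine ⟨C₁, C₂, hC₁, hC₂, fun R hR2 => ?_⟩
  obtain ⟨c₃, hc₃, U₀, hU₀, h'⟩ := h R hR2
  refine ⟨c₃, hc₃, U₀, hU₀, ?_⟩
  intro P c hP hc hc6 hc₃' μ hμ U hU hU9 hU₀' β hβmin hβc K hK L M _ _ hL3 hM3 d Kb D hd hKbN hD A lam Q Ab Qb hA hlam hQ hAb hQb
    Nb hNb0 hcar hlawb W Z A' Q' hW hZ hA'1 hQ'1 hQ'0 σ Φ ψ τ ι₁ ι₂ ι₃ X hσ hΦ hψ hτ hXι hAQι hbase hbase3 hι₁ hι₂ hcell Zk hZ1 hZsucc hstep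
    hx₁ hx₂ hx₃ hy hθ hu₁ hu₂ hclose
  have hβ : 0 < β := KLRegimeSplit.pos_of_klBetaMin_le hβmin
  -- the profile constants of the base `R` rows and their domination by `A′, Q′`
  set AR : ℝ := (27 : ℝ) ^ 5 * (C₁ / C₂) * (8 : ℝ) ^ (d - 1) * (Ab + A / (1 - ((2 : ℝ) ^ d)⁻¹)) with hAR
  set QR : ℝ := C₂ ^ 2 * ((2 : ℝ) ^ (d - 1))⁻¹ * max Q Qb with hQR
  have hρ1 : ((2 : ℝ) ^ d)⁻¹ < 1 := inv_lt_one_of_one_lt₀ (one_lt_pow₀ (by norm_num) (by omega))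
  have hAR0 : 0 ≤ AR := by
    have : 0 ≤ A / (1 - ((2 : ℝ) ^ d)⁻¹) := div_nonneg hA (sub_nonneg.2 hρ1.le)
    positivity
  have hQR0 : 0 ≤ QR := by
    have : 0 ≤ max Q Qb := le_max_of_le_left hQ.le
    positivity
  have hA'0 : 0 ≤ A' := le_trans (by positivity) hA'1
  have hdom : ∀ m : ℕ, W * Z ^ m * (AR * lam ^ (m - 1) * QR ^ m) ≤ A' * lam ^ (m - 1) * Q' ^ m := fun m => by
    rw [show W * Z ^ m * (AR * lam ^ (m - 1) * QR ^ m) = W * AR * lam ^ (m - 1) * (Z * QR) ^ m by rw [mul_pow]; ring]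
    exact mul_le_mul (mul_le_mul_of_nonneg_right hA'1 (pow_nonneg hlam.le _)) (pow_le_pow_left₀ (by positivity) hQ'1 m)
      (pow_nonneg (by positivity) _) (by positivity)
  have hWZ : ∀ m : ℕ, 0 ≤ W * Z ^ m := fun m => by positivity
  have hkN : ∀ k, k ≤ Kb → d * k - 1 ≤ nScales β + 1 := fun k hk =>
    le_trans (Nat.sub_le_sub_right (Nat.mul_le_mul_left d hk) 1) hKbN
  refine klTowerBLevF_le_law_of_inputs_base_tokX hβ U μ K d Kb D hD hA hlam hQ.le hW.le hZ.le hA'0 hQ'0 hσ hΦ hψ hτ hbase hbase3 ?_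
    hι₁ hι₂ hZ1 hZsucc hstep hx₁ hx₂ hx₃ hy hθ hu₁ hu₂ hclose
  -- the bridge `hR` at the blocks `2 ≤ k ≤ K_b`, from the re-based `R` rows
  intro k hk2 hkK ih
  have hrow := h' P c hP hc hc6 hc₃' μ hμ U hU hU9 hU₀' β hβmin hβc K hK L M hL3 hM3 d k hd hk2 (hkN k hkK) D A lam Q Ab Qb hA hlam.le hQ.le hAb hQb
    Nb hNb0 hcar hlawb ih
  refine ⟨fun m hm hmD => (mul_le_mul_of_nonneg_left (hrow.1 m hm hmD) (hWZ m)).trans (hdom m), fun hD3 => ?_⟩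
  refine (mul_le_mul_of_nonneg_left (hrow.2 (X * lam ^ 2) hD3 (hcell k hk2 hkK)) (hWZ 3)).trans ?_
  rw [mul_max_of_nonneg _ _ (hWZ 3)]
  refine max_le ?_ ?_
  · calc W * Z ^ 3 * (X * lam ^ 2) = W * Z ^ 3 * X * lam ^ 2 := by ring
      _ ≤ ι₃ * lam ^ 2 := mul_le_mul_of_nonneg_right hXι (sq_nonneg _)
  · calc W * Z ^ 3 * (AR * lam ^ 2 * QR ^ 3) = W * Z ^ 3 * (AR * lam ^ (3 - 1) * QR ^ 3) := by norm_num
      _ ≤ A' * lam ^ (3 - 1) * Q' ^ 3 := hdom 3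
      _ = A' * Q' ^ 3 * lam ^ 2 := by ring
      _ ≤ ι₃ * lam ^ 2 := mul_le_mul_of_nonneg_right hAQι (sq_nonneg _)

end Summit.HubbardSuperconductivity.HubbardSuperconductivity.Theorems.EngineV8

end
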